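import Summits.HodgeConjecture.CorCM.GaloisQuaternionCyclicPrimeTwoSheet
import Mathlib.GroupTheory.SemidirectProduct
import HarnessLib

/-!
# The two-sheet model of `C_p ⋊ C₈`: odd character sums are NORM FORMS for `ℚ(i, ζ_p) / ℚ(i, ζ_p + ζ_p⁻¹)`

COR-CM (cell `pub-hodgecm2`), binder seat b04 (gen 25), count-neutral claim CYCLIC-SEMIDIRECT-EIGHT, part I (the
group-theoretic core; sequel of QUATERNION-CYCLIC-PRIME part I `CorCM/GaloisQuaternionCyclicPrimeTwoSheet`, whose norm-form
method it transposes from `Q₈ × C_p` to the second family of gen 20's list (iii) «groups with a unique involution and a cyclic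
Sylow 2-subgroup `O ⋊ C_{2^{k+1}}`»).  KERNEL ONLY: theorems; no definition, no named fact, no `sorry`.  `HC_CM` is neither used
nor claimed.

SETTING.  `G₀ = C_p ⋊ C₈ = ⟨u, y | u^p = y^8 = 1, y u y⁻¹ = u⁻¹⟩` (`p` an odd prime), modelled as Mathlib's
`Multiplicative (ZMod p) ⋊[φ] Multiplicative (ZMod 8)` for ANY action `φ` with `φ(1) = inversion` (`hφ`).  Unique involution
`c₀ = y⁴ = inr 4`; abelian subgroup of index two `A = ⟨y²⟩ × ⟨u⟩ ≅ ℤ/4 × ℤ/p` (cyclic of order `4p`), `G₀ = i(A) ⊔ i(A)·y`,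
`y i(t, v) y⁻¹ = i(t, v⁻¹)` (`θ` = inversion on the `ℤ/p`-factor — for `Q₈ × C_p` it was the `ℤ/4`-factor), `y² = i(1, 0) = q`,
`c = (2, 0)`.  For an odd character `χ = ψ ⊗ λ` (`ω = ψ(1)`, `ω² = -1`) the two-sheet determinant is
`Δ(χ) = Ŝ₁(χ)Ŝ₁(χθ) − ω·Ŝ₂(χ)Ŝ₂(χθ)` and, element by element, `χ(t, v⁻¹) = ρ(χ(t, v))` for ANY ring map `ρ` out of a subfield
`M ⊆ ℂ` containing `μ_{4p}` which fixes `μ₄` and inverts `μ_p` (for `M = ℚ(ζ_{4p})`: the automorphism `ζ_{4p} ↦ ζ_{4p}^a`,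
`a ≡ 1 (4)`, `a ≡ −1 (p)`, with fixed field `ℚ(i, ζ_p + ζ_p⁻¹)`).  Hence `Ŝ(χθ) = ρ(Ŝ(χ))` and
  `Δ(χ) = N(z₁) − ω N(z₂)`, `N(z) = z ρ(z)`.
If `ω = ±i` is NOT of the form `N(z₁)/N(z₂)` («`±i` is not a norm from `ℚ(ζ_{4p})` to `ℚ(i, ζ_p⁺)`», hypothesis `hN`; by part III
this holds iff `p ≡ 5 (mod 8)`), then `Δ(χ) = 0` forces `Ŝ₁(χ) = Ŝ₂(χ) = 0`, and the cyclic lemma of order `2²·p` makes both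
sheets `C_p`-periodic: `S` has the left stabiliser `u⁴ ≠ 1`.  Seat census (exhaustive two-sheet, this gen): `C₃ ⋊ C₈` 576,
`C₇ ⋊ C₈` ≈ 9·10⁴ primitive degenerate types (BAD: `p ≡ 3, 7 (mod 8)`), `C₅ ⋊ C₈` NONE (GOOD: `p ≡ 5 (mod 8)`).

* §1 `character_normForm'`, `sum_character_normForm'`, `sums_eq_zero_of_det_eq_zero'` — norm forms through `ρ`.
* §2 `phi_two_pow`, `involution_eq`, `card_eq` — the action, the unique involution `inr 4`, `|G₀| = 8p`.
* §3 **`eq_zero_of_annihilated_cyclicSemidirectEight`** — the model theorem (input of gen 20's annihilator criterion).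

## References

* [Kubota1965] T. Kubota, *On the field extension by complex multiplication*, Trans. AMS 118 (1965), §4 Lemma 2.
* [Dodson1984] B. Dodson, *The structure of Galois groups of CM-fields*, Trans. AMS 283 (1984), §3.1, §5.3.
* [Gordon1999HodgeAVSurvey] B. B. Gordon, *A survey of the Hodge conjecture for abelian varieties*, Prop. 9.4.1, §9.4.
-/

noncomputable section

open scoped BigOperators

namespace Summit.HodgeConjecture.CorCM.GaloisCyclicSemidirectEight

open Literature.NumberTheory.ComplexMultiplication (IsCMTypeWith)
open Summit.HodgeConjecture.CorCM.CyclicTwoPower (mul_pow_mem_iff_of_sum_eq_zero)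
open Summit.HodgeConjecture.CorCM.GaloisQuaternionCyclic (gen_mul_gen omega_mul_omega orderOf_gamma mem_powers_gamma)
open AddChar

/-! ## §1 Norm forms through an auxiliary embedding `ρ` -/

section NormForm

variable {p : ℕ}
variable (χ : AddChar (Additive (Multiplicative (ZMod (2 * 2)) × Multiplicative (ZMod p))) ℂ)
variable (M : Subfield ℂ) (ρ : M →+* ℂ) (hM : ∀ z : ℂ, z ^ (4 * p) = 1 → z ∈ M)
  (hρ4 : ∀ z : M, (z : ℂ) ^ 4 = 1 → ρ z = z) (hρp : ∀ z : M, (z : ℂ) ^ p = 1 → ρ z = (z : ℂ)⁻¹)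
include hM hρ4 hρp

/-- **The norm form, one element at a time**: `χ(t, v) ∈ M` and `ρ(χ(t, v)) = χ(t, v⁻¹)`. [folklore] -/
theorem character_normForm' (w : Multiplicative (ZMod (2 * 2)) × Multiplicative (ZMod p)) :
    ∃ m : M, (m : ℂ) = χ (Additive.ofMul w) ∧ ρ m = χ (Additive.ofMul (w.1, w.2⁻¹)) := by
  obtain ⟨t, v⟩ := w
  -- `ψ = χ(t, 0)` is a fourth root of unity, `ℓ = χ(0, v)` a `p`-th root of unity
  set ψ : ℂ := χ (Additive.ofMul (t, (1 : Multiplicative (ZMod p)))) with hψ_def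
  set ℓ : ℂ := χ (Additive.ofMul ((1 : Multiplicative (ZMod (2 * 2))), v)) with hℓ_def
  have h40 : (4 : ZMod (2 * 2)) = 0 := by decide
  have hψ4 : ψ ^ 4 = 1 := by
    rw [hψ_def, ← map_nsmul_eq_pow, ← ofMul_pow, Prod.pow_mk, one_pow]
    have ht : t ^ 4 = 1 := by
      rw [← ofAdd_toAdd t, ← ofAdd_nsmul, nsmul_eq_mul, Nat.cast_ofNat, h40, zero_mul]; rfl
    rw [ht, ← Prod.one_eq_mk, ofMul_one, map_zero_eq_one]
  have hℓp : ℓ ^ p = 1 := by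
    rw [hℓ_def, ← map_nsmul_eq_pow, ← ofMul_pow, Prod.pow_mk, one_pow]
    have hv : v ^ p = 1 := by
      rw [← ofAdd_toAdd v, ← ofAdd_nsmul, nsmul_eq_mul, ZMod.natCast_self, zero_mul]; rfl
    rw [hv, ← Prod.one_eq_mk, ofMul_one, map_zero_eq_one]
  have hψM : ψ ∈ M := hM ψ (by rw [pow_mul, hψ4, one_pow])
  have hℓM : ℓ ∈ M := hM ℓ (by rw [mul_comm, pow_mul, hℓp, one_pow])
  have hsplit : χ (Additive.ofMul (t, v)) = ψ * ℓ := by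
    rw [hψ_def, hℓ_def, ← map_add_eq_mul, ← ofMul_mul, Prod.mk_mul_mk, mul_one, one_mul]
  have hsplit' : χ (Additive.ofMul (t, v⁻¹)) = ψ * ℓ⁻¹ := by
    rw [hψ_def, hℓ_def, ← map_neg_eq_inv, ← ofMul_inv, Prod.inv_mk, inv_one, ← map_add_eq_mul, ← ofMul_mul,
      Prod.mk_mul_mk, mul_one, one_mul]
  refine ⟨⟨ψ, hψM⟩ * ⟨ℓ, hℓM⟩, ?_, ?_⟩
  · rw [hsplit]; rfl
  · rw [map_mul, hρ4 ⟨ψ, hψM⟩ hψ4, hρp ⟨ℓ, hℓM⟩ hℓp, hsplit']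

/-- **The norm form of a character sum**: `Σ_T χ ∈ M` and `ρ(Σ_T χ) = Σ_T χ∘θ`, `θ(t, v) = (t, v⁻¹)`.
[cite: Kubota1965, §4 Lemma 2] -/
theorem sum_character_normForm' (T : Finset (Multiplicative (ZMod (2 * 2)) × Multiplicative (ZMod p))) :
    ∃ m : M, (m : ℂ) = ∑ w ∈ T, χ (Additive.ofMul w) ∧ ρ m = ∑ w ∈ T, χ (Additive.ofMul (w.1, w.2⁻¹)) := by
  choose m hm hρm using character_normForm' χ M ρ hM hρ4 hρp
  refine ⟨∑ w ∈ T, m w, ?_, ?_⟩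
  · rw [show (((∑ w ∈ T, m w : M)) : ℂ) = ∑ w ∈ T, (m w : ℂ) from map_sum M.subtype _ _]
    exact Finset.sum_congr rfl fun w _ => hm w
  · rw [map_sum]
    exact Finset.sum_congr rfl fun w _ => hρm w

/-- **`Δ(χ) = 0` kills both sheet sums** when `ω = χ(1, 0)` is not a quotient of norms `z ρ(z)`:
`Ŝ₁(χ)Ŝ₁(χθ) − ω Ŝ₂(χ)Ŝ₂(χθ) = N(z₁) − ω N(z₂) = 0` forces `Ŝ₁(χ) = Ŝ₂(χ) = 0`. [cite: Kubota1965, §4 Lemma 2] -/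
theorem sums_eq_zero_of_det_eq_zero'
    (hN : ∀ (z₁ z₂ : M) (ω : ℂ), ω ^ 2 = -1 → (z₁ : ℂ) * ρ z₁ = ω * ((z₂ : ℂ) * ρ z₂) →
      (z₁ : ℂ) = 0 ∧ (z₂ : ℂ) = 0)
    (hχ : χ (Additive.ofMul (Multiplicative.ofAdd (2 : ZMod (2 * 2)), (1 : Multiplicative (ZMod p)))) = -1)
    (S₁ S₂ : Finset (Multiplicative (ZMod (2 * 2)) × Multiplicative (ZMod p)))
    (hΔ : (∑ s ∈ S₁, χ (Additive.ofMul s)) * (∑ s ∈ S₁, χ (Additive.ofMul (s.1, s.2⁻¹))) -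
      χ (Additive.ofMul (Multiplicative.ofAdd (1 : ZMod (2 * 2)), (1 : Multiplicative (ZMod p)))) *
        ((∑ t ∈ S₂, χ (Additive.ofMul t)) * (∑ t ∈ S₂, χ (Additive.ofMul (t.1, t.2⁻¹)))) = 0) :
    ∑ s ∈ S₁, χ (Additive.ofMul s) = 0 ∧ ∑ t ∈ S₂, χ (Additive.ofMul t) = 0 := by
  obtain ⟨m₁, h1, h1θ⟩ := sum_character_normForm' χ M ρ hM hρ4 hρp S₁
  obtain ⟨m₂, h2, h2θ⟩ := sum_character_normForm' χ M ρ hM hρ4 hρp S₂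
  have hωω := omega_mul_omega χ hχ
  rw [← h1, ← h1θ, ← h2, ← h2θ] at hΔ
  obtain ⟨hz₁, hz₂⟩ := hN m₁ m₂ _ (by rw [pow_two, hωω]) (by linear_combination hΔ)
  rw [← h1, ← h2, hz₁, hz₂]
  exact ⟨rfl, rfl⟩

end NormForm

/-! ## §2 The group `C_p ⋊ C₈` -/

section Group

variable {p : ℕ}
variable (φ : Multiplicative (ZMod 8) →* MulAut (Multiplicative (ZMod p)))
  (hφ : ∀ v : Multiplicative (ZMod p), φ (Multiplicative.ofAdd 1) v = v⁻¹)
include hφ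

/-- The action: `φ(m) = inversion^{m}`; in particular `φ(2)^k = 1`. [folklore] -/
theorem phi_two_pow (k : ℕ) (v : Multiplicative (ZMod p)) : φ (Multiplicative.ofAdd (2 : ZMod 8) ^ k) v = v := by
  have h2 : ∀ w : Multiplicative (ZMod p), φ (Multiplicative.ofAdd (2 : ZMod 8)) w = w := fun w => by
    rw [show (2 : ZMod 8) = 1 + 1 by norm_num, ofAdd_add, map_mul, MulAut.mul_apply, hφ, hφ, inv_inv]
  induction k generalizing v with
  | zero => rw [pow_zero, map_one, MulAut.one_apply]
  | succ k ih => rw [pow_succ, map_mul, MulAut.mul_apply, h2, ih]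

omit hφ in
/-- In `C_p` (`p` odd) only `1` squares to `1`. [folklore] -/
theorem eq_one_of_mul_self (hp : p.Prime) (hp2 : p ≠ 2) (v : Multiplicative (ZMod p)) (hv : v * v = 1) : v = 1 := by
  haveI : Fact p.Prime := ⟨hp⟩
  have h2 : (2 : ZMod p) ≠ 0 := by
    rw [Ne, show (2 : ZMod p) = ((2 : ℕ) : ZMod p) by norm_num, ZMod.natCast_eq_zero_iff]
    intro h
    exact hp2 ((Nat.prime_dvd_prime_iff_eq hp Nat.prime_two).1 h)
  have h : (2 : ZMod p) * Multiplicative.toAdd v = 0 := by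
    rw [two_mul, ← toAdd_mul, hv, toAdd_one]
  rcases mul_eq_zero.1 h with h | h
  · exact absurd h h2
  · rw [← ofAdd_toAdd v, h]; rfl

omit hφ in
/-- `m² = 1` in `ℤ/8` forces `m ∈ {0, 4}`. [folklore] -/
theorem eq_zero_or_eq_four_of_two_mul (m : ZMod 8) (hm : m + m = 0) : m = 0 ∨ m = 4 := by
  revert m; decide

/-- **`y⁴ = inr 4` is the unique involution of `C_p ⋊ C₈`** (`p` an odd prime). [cite: Dodson1984, §5.3] -/
theorem involution_eq (hp : p.Prime) (hp2 : p ≠ 2)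
    (g : Multiplicative (ZMod p) ⋊[φ] Multiplicative (ZMod 8)) (hg : g * g = 1) (hg1 : g ≠ 1) :
    g = SemidirectProduct.inr (Multiplicative.ofAdd 4) := by
  obtain ⟨v, m⟩ := g
  have hr : m * m = 1 := by have := congrArg SemidirectProduct.right hg; simpa using this
  have hm : Multiplicative.toAdd m = 0 ∨ Multiplicative.toAdd m = 4 :=
    eq_zero_or_eq_four_of_two_mul _ (by rw [← toAdd_mul, hr, toAdd_one])
  -- `φ m = 1` as `m ∈ {0, 4}` is even
  have hφm : ∀ w, φ m w = w := fun w => by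
    rcases hm with h | h
    · rw [show m = 1 by rw [← ofAdd_toAdd m, h]; rfl, map_one, MulAut.one_apply]
    · have h4 : m = Multiplicative.ofAdd (2 : ZMod 8) ^ 2 := by
        rw [← ofAdd_toAdd m, h, ← ofAdd_nsmul]; decide
      rw [h4, phi_two_pow φ hφ]
  have hl : v * v = 1 := by
    have := congrArg SemidirectProduct.left hg
    simpa [hφm] using this
  have hv : v = 1 := eq_one_of_mul_self hp hp2 v hl
  subst hv
  rcases hm with h | h
  · exfalso; apply hg1
    have : m = 1 := by rw [← ofAdd_toAdd m, h]; rfl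
    subst this; rfl
  · have : m = Multiplicative.ofAdd 4 := by rw [← ofAdd_toAdd m, h]
    subst this; rfl

omit hφ in
/-- `|C_p ⋊ C₈| = 8p`. [folklore] -/
theorem card_eq [NeZero p] [Fintype (Multiplicative (ZMod p) ⋊[φ] Multiplicative (ZMod 8))] :
    Fintype.card (Multiplicative (ZMod p) ⋊[φ] Multiplicative (ZMod 8)) = 8 * p := by
  rw [Fintype.card_congr SemidirectProduct.equivProd, Fintype.card_prod, Fintype.card_multiplicative,
    Fintype.card_multiplicative, ZMod.card, ZMod.card, mul_comm]

end Group

/-! ## §3 The two-sheet model theorem -/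

section Model

variable {p : ℕ} [Fact p.Prime]

/-- **THE MODEL THEOREM.**  `p` an odd prime; `G₀ = C_p ⋊ C₈` (`φ(1)` = inversion); `M ⊆ ℂ` a subfield containing the
`4p`-th roots of unity with a ring map `ρ : M → ℂ` fixing `μ₄` and inverting `μ_p`, such that `±i` is not a quotient of two
«norms» `z ρ(z)` (`hN`).  If `S ⊆ G₀` is a CM set for `c₀ = inr 4 = y⁴` and `u⁴ = inl 4` is not a left stabiliser of `S`,
then every `c₀`-antisymmetric `b : G₀ → ℚ` annihilated by all right translates of `S` is zero.
[cite: Kubota1965, §4 Lemma 2] [cite: Dodson1984, §5.3] -/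
theorem eq_zero_of_annihilated_cyclicSemidirectEight (hp2 : p ≠ 2)
    (φ : Multiplicative (ZMod 8) →* MulAut (Multiplicative (ZMod p)))
    (hφ : ∀ v : Multiplicative (ZMod p), φ (Multiplicative.ofAdd 1) v = v⁻¹)
    (M : Subfield ℂ) (ρ : M →+* ℂ) (hM : ∀ z : ℂ, z ^ (4 * p) = 1 → z ∈ M)
    (hρ4 : ∀ z : M, (z : ℂ) ^ 4 = 1 → ρ z = z) (hρp : ∀ z : M, (z : ℂ) ^ p = 1 → ρ z = (z : ℂ)⁻¹)
    (hN : ∀ (z₁ z₂ : M) (ω : ℂ), ω ^ 2 = -1 → (z₁ : ℂ) * ρ z₁ = ω * ((z₂ : ℂ) * ρ z₂) →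
      (z₁ : ℂ) = 0 ∧ (z₂ : ℂ) = 0)
    (S : Finset (Multiplicative (ZMod p) ⋊[φ] Multiplicative (ZMod 8)))
    (hScm : ∀ g, SemidirectProduct.inr (Multiplicative.ofAdd (4 : ZMod 8)) * g ∈ S ↔ g ∉ S)
    (hstab : ¬ ∀ w, w ∈ S ↔ SemidirectProduct.inl (Multiplicative.ofAdd (4 : ZMod p)) * w ∈ S)
    (b : Multiplicative (ZMod p) ⋊[φ] Multiplicative (ZMod 8) → ℚ)
    (hb : ∀ g, b (SemidirectProduct.inr (Multiplicative.ofAdd (4 : ZMod 8)) * g) = -b g)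
    (hann : ∀ g, ∑ s ∈ S, b (s * g) = 0) : b = 0 := by
  classical
  have hp : p.Prime := Fact.out
  haveI : NeZero p := ⟨hp.ne_zero⟩
  haveI : Fintype (Multiplicative (ZMod p) ⋊[φ] Multiplicative (ZMod 8)) :=
    Fintype.ofEquiv _ SemidirectProduct.equivProd.symm
  -- `2 ∈ ℤ/8` has order `4`
  have h24 : Multiplicative.ofAdd (2 : ZMod 8) ^ 4 = 1 := by
    rw [← ofAdd_nsmul]; decide
  -- the abelian subgroup `⟨y²⟩ × ⟨u⟩ ≅ ℤ/4 × ℤ/p`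
  let f : Multiplicative (ZMod (2 * 2)) × Multiplicative (ZMod p) →
      Multiplicative (ZMod p) ⋊[φ] Multiplicative (ZMod 8) :=
    fun w => ⟨w.2, Multiplicative.ofAdd (2 : ZMod 8) ^ (Multiplicative.toAdd w.1).val⟩
  have hf_apply : ∀ w, f w = ⟨w.2, Multiplicative.ofAdd (2 : ZMod 8) ^ (Multiplicative.toAdd w.1).val⟩ :=
    fun w => rfl
  let i : Multiplicative (ZMod (2 * 2)) × Multiplicative (ZMod p) →*
      Multiplicative (ZMod p) ⋊[φ] Multiplicative (ZMod 8) :=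
    MonoidHom.mk' f fun w w' => by
      refine SemidirectProduct.ext ?_ ?_
      · simp only [hf_apply, SemidirectProduct.mul_left, Prod.snd_mul, phi_two_pow φ hφ]
      · simp only [hf_apply, SemidirectProduct.mul_right, Prod.fst_mul, toAdd_mul, ← pow_add]
        rw [ZMod.val_add, ← pow_eq_pow_mod _ h24]
  have hi_apply : ∀ w, i w = ⟨w.2, Multiplicative.ofAdd (2 : ZMod 8) ^ (Multiplicative.toAdd w.1).val⟩ :=
    fun w => rfl
  -- powers of `2 ∈ ℤ/8` with exponent `< 4` are injective and never `1 ∈ ℤ/8`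
  have hval4 : ∀ t : Multiplicative (ZMod (2 * 2)), (Multiplicative.toAdd t).val < 4 := fun t => ZMod.val_lt _
  have hpow2 : ∀ k : ℕ, Multiplicative.ofAdd (2 : ZMod 8) ^ k = Multiplicative.ofAdd ((2 * k : ℕ) : ZMod 8) :=
    fun k => by rw [← ofAdd_nsmul, nsmul_eq_mul, Nat.cast_mul, Nat.cast_ofNat, mul_comm]
  have hinj2 : ∀ k k' : ℕ, k < 4 → k' < 4 →
      Multiplicative.ofAdd (2 : ZMod 8) ^ k = Multiplicative.ofAdd (2 : ZMod 8) ^ k' → k = k' := by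
    intro k k' hk hk' h
    rw [hpow2, hpow2, Equiv.apply_eq_iff_eq, ZMod.natCast_eq_natCast_iff'] at h
    omega
  have hne1 : ∀ k : ℕ, Multiplicative.ofAdd (2 : ZMod 8) ^ k ≠ Multiplicative.ofAdd 1 := by
    intro k h
    rw [hpow2, Equiv.apply_eq_iff_eq, show (1 : ZMod 8) = ((1 : ℕ) : ZMod 8) by norm_num,
      ZMod.natCast_eq_natCast_iff'] at h
    omega
  have hi : Function.Injective i := by
    rintro ⟨t, v⟩ ⟨t', v'⟩ h
    rw [hi_apply, hi_apply, SemidirectProduct.ext_iff] at h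
    refine Prod.ext ?_ h.1
    have := hinj2 _ _ (hval4 t) (hval4 t') h.2
    exact Multiplicative.toAdd.injective (ZMod.val_injective _ this)
  -- the second sheet `i(A) · y`, `y = inr 1`
  set y : Multiplicative (ZMod p) ⋊[φ] Multiplicative (ZMod 8) :=
    SemidirectProduct.inr (Multiplicative.ofAdd (1 : ZMod 8)) with hy_def
  have hy : y = ⟨1, Multiplicative.ofAdd 1⟩ := rfl
  have hx : ∀ w, i w ≠ y := fun ⟨t, v⟩ h => by
    rw [hi_apply, hy, SemidirectProduct.ext_iff] at h
    exact hne1 _ h.2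
  have hcov : ∀ g : Multiplicative (ZMod p) ⋊[φ] Multiplicative (ZMod 8), (∃ w, g = i w) ∨ (∃ w, g = i w * y) := by
    rintro ⟨v, m⟩
    set n : ℕ := (Multiplicative.toAdd m).val with hn_def
    have hn8 : n < 8 := ZMod.val_lt _
    have hk4 : ((n / 2 : ℕ) : ZMod (2 * 2)).val = n / 2 := ZMod.val_natCast_of_lt (by omega)
    have hm : m = Multiplicative.ofAdd (2 : ZMod 8) ^ (n / 2) * Multiplicative.ofAdd (1 : ZMod 8) ^ (n % 2) := by
      rw [← ofAdd_nsmul, ← ofAdd_nsmul, ← ofAdd_add, nsmul_eq_mul, nsmul_eq_mul]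
      conv_lhs => rw [← ofAdd_toAdd m, ← ZMod.natCast_zmod_val (Multiplicative.toAdd m)]
      rw [← hn_def, ← Nat.div_add_mod n 2]
      congr 1
      have e : (2 * (n / 2) + n % 2) / 2 = n / 2 := by omega
      have e' : (2 * (n / 2) + n % 2) % 2 = n % 2 := by omega
      rw [e, e']
      push_cast
      ring
    rcases Nat.mod_two_eq_zero_or_one n with h0 | h1
    · refine Or.inl ⟨(Multiplicative.ofAdd ((n / 2 : ℕ) : ZMod (2 * 2)), v), ?_⟩
      rw [hi_apply, toAdd_ofAdd, hk4, hm, h0, pow_zero, mul_one]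
    · refine Or.inr ⟨(Multiplicative.ofAdd ((n / 2 : ℕ) : ZMod (2 * 2)), v), ?_⟩
      rw [hi_apply, toAdd_ofAdd, hk4, hy, SemidirectProduct.mul_def]
      refine SemidirectProduct.ext ?_ ?_
      · simp
      · simpa [h1] using hm
  -- conjugation by `y` inverts the `ℤ/p`-factor; `y² = i(1, 0)`
  let θ : Multiplicative (ZMod (2 * 2)) × Multiplicative (ZMod p) ≃*
      Multiplicative (ZMod (2 * 2)) × Multiplicative (ZMod p) :=
    MulEquiv.prodCongr (MulEquiv.refl _) (MulEquiv.inv _)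
  have hθ_apply : ∀ w, θ w = (w.1, w.2⁻¹) := fun w => rfl
  have hθ : ∀ w, y * i w = i (θ w) * y := fun ⟨t, v⟩ => by
    rw [hi_apply, hi_apply, hθ_apply, hy, SemidirectProduct.mul_def, SemidirectProduct.mul_def]
    refine SemidirectProduct.ext ?_ ?_
    · simp [hφ]
    · simp [mul_comm]
  set q : Multiplicative (ZMod (2 * 2)) × Multiplicative (ZMod p) := (Multiplicative.ofAdd 1, 1) with hq_def
  have h1val : (1 : ZMod (2 * 2)).val = 1 := by decide
  have h2val : (2 : ZMod (2 * 2)).val = 2 := by decide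
  have hyy : y * y = i q := by
    rw [hi_apply, hq_def, toAdd_ofAdd, h1val, pow_one, hy, SemidirectProduct.mul_def]
    refine SemidirectProduct.ext ?_ ?_
    · simp
    · change Multiplicative.ofAdd (1 : ZMod 8) * Multiplicative.ofAdd 1 = Multiplicative.ofAdd 2
      rw [← ofAdd_add]; norm_num
  set c : Multiplicative (ZMod (2 * 2)) × Multiplicative (ZMod p) := (Multiplicative.ofAdd 2, 1) with hc_def
  have hic : i c = SemidirectProduct.inr (Multiplicative.ofAdd (4 : ZMod 8)) := by
    rw [hi_apply, hc_def, toAdd_ofAdd, h2val, hpow2]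
    rfl
  have h22 : (2 : ZMod (2 * 2)) + 2 = 0 := by decide
  have hcc : c * c = 1 := by
    rw [hc_def, Prod.mk_mul_mk, mul_one, ← ofAdd_add, h22]; rfl
  have hθc : θ c = c := by rw [hθ_apply, hc_def, inv_one]
  -- the two sheets of `S`
  set S₁ : Finset (Multiplicative (ZMod (2 * 2)) × Multiplicative (ZMod p)) :=
    Finset.univ.filter fun w => i w ∈ S with hS₁_def
  set S₂ : Finset (Multiplicative (ZMod (2 * 2)) × Multiplicative (ZMod p)) :=
    Finset.univ.filter fun w => i w * y ∈ S with hS₂_def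
  have hS₁ : ∀ w, w ∈ S₁ ↔ i w ∈ S := fun w => by simp [hS₁_def]
  have hS₂ : ∀ w, w ∈ S₂ ↔ i w * y ∈ S := fun w => by simp [hS₂_def]
  have hS₁cm : IsCMTypeWith c (↑S₁ : Set (Multiplicative (ZMod (2 * 2)) × Multiplicative (ZMod p))) := by
    refine ⟨fun w => ?_, fun g w => ?_, fun w => ?_⟩
    · rw [Finset.mem_coe, Finset.mem_coe, hS₁, hS₁, smul_eq_mul, map_mul, hic, hScm, not_not]
    · simp only [smul_eq_mul, mul_left_comm]
    · rw [smul_eq_mul, smul_eq_mul, ← mul_assoc, hcc, one_mul]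
  have hS₂cm : IsCMTypeWith c (↑S₂ : Set (Multiplicative (ZMod (2 * 2)) × Multiplicative (ZMod p))) := by
    refine ⟨fun w => ?_, fun g w => ?_, fun w => ?_⟩
    · rw [Finset.mem_coe, Finset.mem_coe, hS₂, hS₂, smul_eq_mul, map_mul, hic, mul_assoc, hScm, not_not]
    · simp only [smul_eq_mul, mul_left_comm]
    · rw [smul_eq_mul, smul_eq_mul, ← mul_assoc, hcc, one_mul]
  -- the stabilising element `γ⁴ = (0, 4) ↦ u⁴ = inl 4`
  have h4 : ((Multiplicative.ofAdd (1 : ZMod (2 * 2)), Multiplicative.ofAdd (1 : ZMod p)) :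
      Multiplicative (ZMod (2 * 2)) × Multiplicative (ZMod p)) ^ 2 ^ (1 + 1) =
      (Multiplicative.ofAdd (4 : ZMod (2 * 2)), Multiplicative.ofAdd (4 : ZMod p)) := by
    rw [Prod.pow_mk, ← ofAdd_nsmul, ← ofAdd_nsmul, nsmul_eq_mul, nsmul_eq_mul, mul_one, mul_one]
    norm_num
  have h40 : (4 : ZMod (2 * 2)) = 0 := by decide
  have hγ4 : i (((Multiplicative.ofAdd (1 : ZMod (2 * 2)), Multiplicative.ofAdd (1 : ZMod p)) :
      Multiplicative (ZMod (2 * 2)) × Multiplicative (ZMod p)) ^ 2 ^ (1 + 1)) =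
      SemidirectProduct.inl (Multiplicative.ofAdd (4 : ZMod p)) := by
    rw [h4, hi_apply, toAdd_ofAdd, h40, ZMod.val_zero, pow_zero]
    rfl
  have hcomm : ∀ w, i (((Multiplicative.ofAdd (1 : ZMod (2 * 2)), Multiplicative.ofAdd (1 : ZMod p)) :
      Multiplicative (ZMod (2 * 2)) × Multiplicative (ZMod p)) ^ 2 ^ (1 + 1)) * i w =
      i (w * ((Multiplicative.ofAdd (1 : ZMod (2 * 2)), Multiplicative.ofAdd (1 : ZMod p)) :
      Multiplicative (ZMod (2 * 2)) × Multiplicative (ZMod p)) ^ 2 ^ (1 + 1)) := fun w => by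
    rw [← map_mul, mul_comm w]
  -- the determinant does not vanish on odd characters
  have hdet : ∀ χ : AddChar (Additive (Multiplicative (ZMod (2 * 2)) × Multiplicative (ZMod p))) ℂ,
      χ (Additive.ofMul c) = -1 →
      (∑ s ∈ S₁, χ (Additive.ofMul s)) * (∑ s ∈ S₁, χ (Additive.ofMul (θ s))) -
        χ (Additive.ofMul q) * ((∑ t ∈ S₂, χ (Additive.ofMul t)) * (∑ t ∈ S₂, χ (Additive.ofMul (θ t)))) ≠ 0 := by
    intro χ hχ hΔ
    simp_rw [hθ_apply] at hΔ
    obtain ⟨h1, h2⟩ := sums_eq_zero_of_det_eq_zero' χ M ρ hM hρ4 hρp hN hχ S₁ S₂ hΔ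
    have hp1 := mul_pow_mem_iff_of_sum_eq_zero (G := Multiplicative (ZMod (2 * 2)) × Multiplicative (ZMod p))
      (a := 1) (q := p) hp hp2 (orderOf_gamma hp2) (mem_powers_gamma hp2) hS₁cm χ hχ h1
    have hp2' := mul_pow_mem_iff_of_sum_eq_zero (G := Multiplicative (ZMod (2 * 2)) × Multiplicative (ZMod p))
      (a := 1) (q := p) hp hp2 (orderOf_gamma hp2) (mem_powers_gamma hp2) hS₂cm χ hχ h2
    apply hstab
    intro w
    rw [← hγ4]
    rcases hcov w with ⟨u, rfl⟩ | ⟨u, rfl⟩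
    · rw [← hS₁, hp1 u, hS₁, ← hcomm]
    · rw [← hS₂, hp2' u, hS₂, ← mul_assoc, hcomm]
  exact TwoSheet.eq_zero_of_twoSheet i hi y hx hcov θ hθ q hyy hcc hθc S S₁ S₂ hS₁ hS₂ hdet b
    (fun g => by rw [hic]; exact hb g) hann

end Model

end Summit.HodgeConjecture.CorCM.GaloisCyclicSemidirectEight

end
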